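import Literature.AlgebraicGeometry.ShimuraVarieties.UnitaryShimuraCurveConeReadSlices
import Literature.NumberTheory.Automorphic.UnitaryCurveCohCotangentForms
import HarnessLib

/-!
# Any adelic lift of the cone-read family lies in the `(1,0) ⊕ (0,1)` cotangent automorphic forms of the unitary Shimura CURVE

Topic `AlgebraicGeometry/ShimuraVarieties`, namespace `…ShimuraVarieties.UnitaryCanonicalModel`.  THEOREMS ONLY (no definition, no named
fact, no instance, no notation, no `sorry`); M5-rec F2 (ii) of the design memo `DESIGN-M5rec` (cell `hodgecm-mathlib`, P5 `F0_AlbCm`, S1-R).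

Let `Φ` be ANY function on `U(J⋆)(𝔸_{L⁺})` with the four properties of the adelic lift (★ `UnitaryGroupAdelicLift.exists_lift_of_pieces`)
at an OPEN level `K`, for the family `u ↦ P_q[α_q](ũ)` of cone reads (★ `UnitaryBallConeCotangentForms`) of holomorphic-in-charts
`1`-forms `α_q` on disc-quotient pieces `(X_q, B_q)` with cone `negCone (J⋆^τ)`, read at the `τ`-frame `(v₀, t₀)` UNTWISTED from a cone
frame `𝔣` of ★ `UnitaryCurveCohCotangentForms` (`𝔣.v₀ = embTwist ∘ v₀`, `𝔣.t₀ = embTwist ∘ t₀`; `embTwist` = `id` ∕ `conj` according as Mathlib's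
embedding `σ` of the place of `τ` is `τ` ∕ `τ̄`), and let the level-`K` representatives cover.  Then (★ M2 ed. 2 right-slice clause (H)):

* `lift_mem_holCotForms₂_of_embedding_eq` — if `σ = τ`, `Φ ∈ holCotForms₂ 𝔣`: the right `w₁`-slice through `x` with `x_f = δ_f g_q k` is
  `m ↦ P_q[α_q]((δ⁻¹)^τ x̃₁ · m̃)` (★ `lift_apply_mul_adelicSingle`), holomorphic with the cotangent law (★ `differentiableAt_coneRead_const_mul`,
  `coneRead_const_mul_mul_of_mulVec_eq_smul`);
* `conjFun₂_lift_mem_holCotForms₂_of_embedding_ne` — if `σ = τ̄`, `conj ∘ Φ ∈ holCotForms₂ 𝔣`: the slice of `conj ∘ Φ` is the CONJUGATED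
  translated read, holomorphic by the symmetry principle (★ `differentiableAt_conj_coneRead_const_mul_conj`), the cotangent law conjugated
  back (`conj (ā k̄⁻¹) = a k⁻¹`);
* `lift_mem_cohForms₂` — IN EITHER CASE `Φ ∈ cohForms₂ 𝔣 = holCotForms₂ ⊔ conj holCotForms₂` (★ `holCotForms₂_le_cohForms₂`,
  `conjFun₂_mem_cohForms₂`): the value clause `∀ x, r x ∈ cohForms₂ 𝔣` of the S1-R letter for the holomorphic half of the realisation.

[Borel1997] §5.13–§5.14; [BorelWallach2000] VII 2.10, 3.6; [BorelJacquet1979] §4.2–§4.3; [AhlforsCA1979] Ch. 4 §6.5 p. 172.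
-/

set_option autoImplicit false

noncomputable section

open Function MulAction Topology NumberField CategoryTheory Matrix AlgebraicGeometry
open scoped Matrix ComplexOrder Manifold ComplexConjugate
open Literature.AlgebraicGeometry.Motives
open Literature.NumberTheory.Automorphic Literature.NumberTheory.Automorphic.UnitaryGroup
open Literature.NumberTheory.Automorphic.UnitaryCurveForms
open Literature.NumberTheory.Automorphic.Liu2021.AppendixC (C5.OpenCompactSubgroup C5.SmallLevel)
open Literature.AlgebraicGeometry.HodgeTheory
open Literature.Geometry.Kaehler (MForm IsHolomorphicInCharts)
open Literature.NumberTheory.Transcendental (IsComplexLinearForm)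

namespace Literature.AlgebraicGeometry.ShimuraVarieties.UnitaryCanonicalModel

variable {L : Type} [Field L] [NumberField L] [IsCMField L] {Jstar : Matrix (Fin 2) (Fin 2) L} {τ : L →+* ℂ}
  {K₀ : C5.OpenCompactSubgroup ↥(finAdelic (↥(maximalRealSubfield L)) L (IsCMField.complexConj L) 2 Jstar)}
  {K : C5.SmallLevel K₀} {Q : Type} {gq : Q → ↥(finAdelic (↥(maximalRealSubfield L)) L (IsCMField.complexConj L) 2 Jstar)}
  {X : Q → SchemeOver ℂ} {B : ∀ q, UnitaryBallUniformisationDatum 1 (X q)}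

/-- **Case `σ = τ`: the lift is a HOLOMORPHIC cotangent automorphic form, `Φ ∈ holCotForms₂ 𝔣`.**  (L), (Kc) are hypotheses; (Sm) is «`K` open +
right-`K`-invariant»; (H) at `x` with `x_f = δ_f g_q k`: the slice is `m ↦ P_q[α_q]((δ⁻¹)^τ x̃₁ · m̃)` (★ `lift_apply_mul_adelicSingle`), `m̃ = m`
here, `IsConeHol` by ★ `differentiableAt_coneRead_const_mul` ∕ `coneRead_const_mul_mul_of_mulVec_eq_smul`.
[cite: Borel1997, §5.13–§5.14] [cite: BorelWallach2000, VII 2.10] [cite: BorelJacquet1979, §4.2–§4.3] -/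
theorem lift_mem_holCotForms₂_of_embedding_eq (hemb : (InfinitePlace.mk τ).embedding = τ)
    (𝔣 : ConeFrame L Jstar (cmPlace L τ)) {v₀ t₀ : Fin 2 → ℂ}
    (hv : 𝔣.v₀ = fun i => embTwist L τ (v₀ i)) (ht : 𝔣.t₀ = fun i => embTwist L τ (t₀ i))
    (hH : ∀ q, (B q).Hℂ = Jstar.map τ) (A : ∀ q, HodgeModel 1 (X q))
    (α : ∀ q, MForm 𝓘(ℝ, (A q).model) (A q).carrier ℂ 1) (hα : ∀ q, IsHolomorphicInCharts (α q))
    (hcov : ∀ y : ↥(finAdelic (↥(maximalRealSubfield L)) L (IsCMField.complexConj L) 2 Jstar),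
      ∃ (q : Q) (δ : ↥(rational (↥(maximalRealSubfield L)) L (IsCMField.complexConj L) 2 Jstar))
        (k : ↥(finAdelic (↥(maximalRealSubfield L)) L (IsCMField.complexConj L) 2 Jstar)),
        k ∈ K.1.1 ∧ y = rationalToFinAdelic (↥(maximalRealSubfield L)) L (IsCMField.complexConj L) 2 Jstar δ * gq q * k)
    {Φ : (adelicGroupData (↥(maximalRealSubfield L)) L (IsCMField.complexConj L) 2 Jstar).Adelic → ℂ}
    (hL : ∀ (δ : ↥(rational (↥(maximalRealSubfield L)) L (IsCMField.complexConj L) 2 Jstar))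
        (x : (adelicGroupData (↥(maximalRealSubfield L)) L (IsCMField.complexConj L) 2 Jstar).Adelic),
      Φ ((adelicGroupData (↥(maximalRealSubfield L)) L (IsCMField.complexConj L) 2 Jstar).toAdelic δ * x) = Φ x)
    (hKc : ∀ k ∈ ((archAt (↥(maximalRealSubfield L)) L (IsCMField.complexConj L) 2 Jstar (cmPlace L τ)
          (complexConj_smul_infinitePlace L _) (IsCMField.complexConj_ne_one L)).ker).map
        (archToAdelic (↥(maximalRealSubfield L)) L (IsCMField.complexConj L) 2 Jstar),
      ∀ x : (adelicGroupData (↥(maximalRealSubfield L)) L (IsCMField.complexConj L) 2 Jstar).Adelic, Φ (x * k) = Φ x)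
    (hK : ∀ k ∈ K.1.1, ∀ x : (adelicGroupData (↥(maximalRealSubfield L)) L (IsCMField.complexConj L) 2 Jstar).Adelic,
      Φ (x * finAdelicToAdelic (↥(maximalRealSubfield L)) L (IsCMField.complexConj L) 2 Jstar k) = Φ x)
    (hΦ : ∀ (q : Q) (u : archLocal L 2 Jstar (cmPlace L τ)),
        Φ (adelicSingle (↥(maximalRealSubfield L)) L (IsCMField.complexConj L) 2 Jstar (IsCMField.complexConj_ne_one L)
            (complexConj_smul_infinitePlace L) (cmPlace L τ) u *
          finAdelicToAdelic (↥(maximalRealSubfield L)) L (IsCMField.complexConj L) 2 Jstar (gq q)) =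
        (α q) ((⇑(A q).isAnalytification.homeomorph.symm ∘ (B q).unif) ((((u : GL (Fin 2) ℂ) : Matrix (Fin 2) (Fin 2) ℂ).map (embTwist L τ)) *ᵥ v₀))
          (fun _ ↦ mfderiv 𝓘(ℝ, Fin 2 → ℂ) 𝓘(ℝ, (A q).model) (⇑(A q).isAnalytification.homeomorph.symm ∘ (B q).unif)
            ((((u : GL (Fin 2) ℂ) : Matrix (Fin 2) (Fin 2) ℂ).map (embTwist L τ)) *ᵥ v₀)
            ((((u : GL (Fin 2) ℂ) : Matrix (Fin 2) (Fin 2) ℂ).map (embTwist L τ)) *ᵥ t₀))) :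
    Φ ∈ holCotForms₂ (↥(maximalRealSubfield L)) L (IsCMField.complexConj L) Jstar (IsCMField.complexConj_ne_one L)
      (complexConj_smul_infinitePlace L) (cmPlace L τ) 𝔣 := by
  -- in this case the twist is the identity
  have hmap : ∀ m : Matrix (Fin 2) (Fin 2) ℂ, m.map (embTwist L τ) = m := fun m => by
    ext i j
    exact embTwist_apply_of_eq L τ hemb _
  have hv' : 𝔣.v₀ = v₀ := by rw [hv]; funext i; exact embTwist_apply_of_eq L τ hemb _
  have ht' : 𝔣.t₀ = t₀ := by rw [ht]; funext i; exact embTwist_apply_of_eq L τ hemb _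
  have hJ : Jstar.map (cmPlace L τ).1.embedding = Jstar.map τ := by
    change Jstar.map (InfinitePlace.mk τ).embedding = _
    rw [hemb]
  refine (mem_holCotForms₂_iff _ _ _ _ _ _ _ 𝔣 Φ).2 ⟨hL, hKc, ⟨K.1.1, K.1.2.1, hK⟩, fun x => ?_⟩
  obtain ⟨q, δ, k, hk, hx⟩ := hcov (finPart (↥(maximalRealSubfield L)) L (IsCMField.complexConj L) 2 Jstar x)
  -- the translation matrix `(δ⁻¹)^τ · x̃₁`
  set Mx : Matrix (Fin 2) (Fin 2) ℂ := ((ratToGLℂ L Jstar τ δ⁻¹ : GL (Fin 2) ℂ) : Matrix (Fin 2) (Fin 2) ℂ) *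
    (((archAt (↥(maximalRealSubfield L)) L (IsCMField.complexConj L) 2 Jstar (cmPlace L τ)
        (complexConj_smul_infinitePlace L _) (IsCMField.complexConj_ne_one L)
        (archPart (↥(maximalRealSubfield L)) L (IsCMField.complexConj L) 2 Jstar x) : archLocal L 2 Jstar (cmPlace L τ)) :
        GL (Fin 2) ℂ) : Matrix (Fin 2) (Fin 2) ℂ).map (embTwist L τ) with hMx
  have hMxneg : ∀ w ∈ negCone (Jstar.map τ), Mx *ᵥ w ∈ negCone (Jstar.map τ) := fun w hw => by
    rw [hMx, ← Matrix.mulVec_mulVec]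
    exact ratToGLℂ_mulVec_mem_negCone' (τ := τ) δ⁻¹ (map_embTwist_mulVec_mem_negCone (τ := τ) _ hw)
  -- the read at a matrix, as a function of the matrix (so that matrix identities transport by `congrArg`)
  let R : Matrix (Fin 2) (Fin 2) ℂ → ℂ := fun m => (α q) ((⇑(A q).isAnalytification.homeomorph.symm ∘ (B q).unif) (m *ᵥ v₀))
    (fun _ ↦ mfderiv 𝓘(ℝ, Fin 2 → ℂ) 𝓘(ℝ, (A q).model) (⇑(A q).isAnalytification.homeomorph.symm ∘ (B q).unif) (m *ᵥ v₀) (m *ᵥ t₀))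
  have hR : ∀ m, R m = (α q) ((⇑(A q).isAnalytification.homeomorph.symm ∘ (B q).unif) (m *ᵥ v₀))
    (fun _ ↦ mfderiv 𝓘(ℝ, Fin 2 → ℂ) 𝓘(ℝ, (A q).model) (⇑(A q).isAnalytification.homeomorph.symm ∘ (B q).unif) (m *ᵥ v₀) (m *ᵥ t₀)) :=
    fun m => rfl
  refine ⟨fun m => R (Mx * m.map (embTwist L τ)), ⟨?_, ?_⟩, fun u => ?_⟩
  · -- (i) holomorphy on the cone-open
    intro g hg
    have hgv : (Mx * Matrix.of g) *ᵥ v₀ ∈ (B q).cone := by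
      change _ ∈ negCone (B q).Hℂ
      rw [hH q, ← Matrix.mulVec_mulVec]
      refine hMxneg _ ?_
      have h2 := hg.2
      rwa [hv', hJ] at h2
    have hfun : (fun g' : Fin 2 → Fin 2 → ℂ => R (Mx * (Matrix.of g').map (embTwist L τ))) =
        fun g' => R (Mx * Matrix.of g') := funext fun g' => congrArg (fun m => R (Mx * m)) (hmap _)
    rw [hfun]
    exact (differentiableAt_coneRead_const_mul (B q) (A q) (hα q) Mx v₀ t₀ hgv).differentiableWithinAt
  · -- (ii) the cotangent law
    intro g b a kk d _ hgneg hkk hb hbt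
    rw [hv'] at hgneg hb hbt
    rw [ht'] at hbt
    rw [hJ] at hgneg
    have hgv : (Mx * g) *ᵥ v₀ ∈ (B q).cone := by
      change _ ∈ negCone (B q).Hℂ
      rw [hH q, ← Matrix.mulVec_mulVec]
      exact hMxneg _ hgneg
    have key := coneRead_const_mul_mul_of_mulVec_eq_smul (B q) (A q) ((hα q).isOfType.isComplexLinearForm) Mx v₀ t₀ hgv hkk hb hbt
    show R (Mx * (g * b).map (embTwist L τ)) = (a * kk⁻¹) * R (Mx * g.map (embTwist L τ))
    rw [congrArg (fun m => R (Mx * m)) (hmap (g * b)), congrArg (fun m => R (Mx * m)) (hmap g)]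
    exact key
  · -- the slice through `x` IS this function on `U(σ(J⋆))(ℂ)`
    show R (Mx * (((u : GL (Fin 2) ℂ) : Matrix (Fin 2) (Fin 2) ℂ).map (embTwist L τ))) = Φ _
    rw [lift_apply_mul_adelicSingle A α v₀ t₀ hL hKc hK hΦ hk hx u]
    exact congrArg R (by rw [hMx, Matrix.mul_assoc])

/-- **Case `σ = τ̄`: the CONJUGATE of the lift is a holomorphic cotangent automorphic form, `conj ∘ Φ ∈ holCotForms₂ 𝔣`** (the frame `𝔣` is the
conjugate of the `τ`-frame; the slice of `conj ∘ Φ` through `x` is `m ↦ conj (P_q[α_q]((δ⁻¹)^τ x̃₁ · m̄))`, holomorphic by the symmetry principle ★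
`differentiableAt_conj_coneRead_const_mul_conj`, with the cotangent law conjugated back: `conj (ā k̄⁻¹) = a k⁻¹`).
[cite: BorelWallach2000, VII 2.10] [cite: AhlforsCA1979, Ch. 4 §6.5 p. 172] [cite: Borel1997, §5.13–§5.14] -/
theorem conjFun₂_lift_mem_holCotForms₂_of_embedding_ne (hemb : (InfinitePlace.mk τ).embedding ≠ τ)
    (𝔣 : ConeFrame L Jstar (cmPlace L τ)) {v₀ t₀ : Fin 2 → ℂ}
    (hv : 𝔣.v₀ = fun i => embTwist L τ (v₀ i)) (ht : 𝔣.t₀ = fun i => embTwist L τ (t₀ i))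
    (hH : ∀ q, (B q).Hℂ = Jstar.map τ) (A : ∀ q, HodgeModel 1 (X q))
    (α : ∀ q, MForm 𝓘(ℝ, (A q).model) (A q).carrier ℂ 1) (hα : ∀ q, IsHolomorphicInCharts (α q))
    (hcov : ∀ y : ↥(finAdelic (↥(maximalRealSubfield L)) L (IsCMField.complexConj L) 2 Jstar),
      ∃ (q : Q) (δ : ↥(rational (↥(maximalRealSubfield L)) L (IsCMField.complexConj L) 2 Jstar))
        (k : ↥(finAdelic (↥(maximalRealSubfield L)) L (IsCMField.complexConj L) 2 Jstar)),
        k ∈ K.1.1 ∧ y = rationalToFinAdelic (↥(maximalRealSubfield L)) L (IsCMField.complexConj L) 2 Jstar δ * gq q * k)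
    {Φ : (adelicGroupData (↥(maximalRealSubfield L)) L (IsCMField.complexConj L) 2 Jstar).Adelic → ℂ}
    (hL : ∀ (δ : ↥(rational (↥(maximalRealSubfield L)) L (IsCMField.complexConj L) 2 Jstar))
        (x : (adelicGroupData (↥(maximalRealSubfield L)) L (IsCMField.complexConj L) 2 Jstar).Adelic),
      Φ ((adelicGroupData (↥(maximalRealSubfield L)) L (IsCMField.complexConj L) 2 Jstar).toAdelic δ * x) = Φ x)
    (hKc : ∀ k ∈ ((archAt (↥(maximalRealSubfield L)) L (IsCMField.complexConj L) 2 Jstar (cmPlace L τ)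
          (complexConj_smul_infinitePlace L _) (IsCMField.complexConj_ne_one L)).ker).map
        (archToAdelic (↥(maximalRealSubfield L)) L (IsCMField.complexConj L) 2 Jstar),
      ∀ x : (adelicGroupData (↥(maximalRealSubfield L)) L (IsCMField.complexConj L) 2 Jstar).Adelic, Φ (x * k) = Φ x)
    (hK : ∀ k ∈ K.1.1, ∀ x : (adelicGroupData (↥(maximalRealSubfield L)) L (IsCMField.complexConj L) 2 Jstar).Adelic,
      Φ (x * finAdelicToAdelic (↥(maximalRealSubfield L)) L (IsCMField.complexConj L) 2 Jstar k) = Φ x)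
    (hΦ : ∀ (q : Q) (u : archLocal L 2 Jstar (cmPlace L τ)),
        Φ (adelicSingle (↥(maximalRealSubfield L)) L (IsCMField.complexConj L) 2 Jstar (IsCMField.complexConj_ne_one L)
            (complexConj_smul_infinitePlace L) (cmPlace L τ) u *
          finAdelicToAdelic (↥(maximalRealSubfield L)) L (IsCMField.complexConj L) 2 Jstar (gq q)) =
        (α q) ((⇑(A q).isAnalytification.homeomorph.symm ∘ (B q).unif) ((((u : GL (Fin 2) ℂ) : Matrix (Fin 2) (Fin 2) ℂ).map (embTwist L τ)) *ᵥ v₀))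
          (fun _ ↦ mfderiv 𝓘(ℝ, Fin 2 → ℂ) 𝓘(ℝ, (A q).model) (⇑(A q).isAnalytification.homeomorph.symm ∘ (B q).unif)
            ((((u : GL (Fin 2) ℂ) : Matrix (Fin 2) (Fin 2) ℂ).map (embTwist L τ)) *ᵥ v₀)
            ((((u : GL (Fin 2) ℂ) : Matrix (Fin 2) (Fin 2) ℂ).map (embTwist L τ)) *ᵥ t₀))) :
    conjFun₂ (↥(maximalRealSubfield L)) L (IsCMField.complexConj L) Jstar Φ ∈
      holCotForms₂ (↥(maximalRealSubfield L)) L (IsCMField.complexConj L) Jstar (IsCMField.complexConj_ne_one L)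
        (complexConj_smul_infinitePlace L) (cmPlace L τ) 𝔣 := by
  -- in this case the twist is conjugation: `ũ = ū`, `𝔣.v₀ = v̄₀`, `𝔣.t₀ = t̄₀`
  have htw : ∀ z : ℂ, embTwist L τ z = conj z := fun z => embTwist_apply_of_ne L τ hemb z
  have hmap : ∀ m : Matrix (Fin 2) (Fin 2) ℂ, m.map (embTwist L τ) = m.map (starRingEnd ℂ) := fun m => by
    ext i j
    exact htw _
  have hv' : 𝔣.v₀ = fun i => conj (v₀ i) := by rw [hv]; funext i; exact htw _
  have ht' : 𝔣.t₀ = fun i => conj (t₀ i) := by rw [ht]; funext i; exact htw _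
  -- entrywise conjugation and `mulVec`: `b̄ v = conj (b v̄)`
  have conj_vec : ∀ (b : Matrix (Fin 2) (Fin 2) ℂ) (w : Fin 2 → ℂ),
      (b.map (starRingEnd ℂ)) *ᵥ w = fun i => conj ((b *ᵥ fun j => conj (w j)) i) := fun b w => by
    funext i
    have hw : (⇑(starRingEnd ℂ) ∘ fun j => conj (w j)) = w := funext fun j => Complex.conj_conj _
    rw [RingHom.map_mulVec (starRingEnd ℂ) b (fun j => conj (w j)) i, hw]
  -- negativity transfers along conjugation: `w ∈ negCone σ(J⋆)` ⇒ `w̄ ∈ negCone J⋆^τ`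
  have neg_of : ∀ w : Fin 2 → ℂ, w ∈ negCone (Jstar.map (cmPlace L τ).1.embedding) → (fun i => conj (w i)) ∈ negCone (Jstar.map τ) :=
    fun w hw => mem_negCone_of_embTwist_eq τ (isComplex_mk_of_isCMField L τ) Jstar (v := w)
      (funext fun i => by rw [htw, Complex.conj_conj]) hw
  refine (mem_holCotForms₂_iff _ _ _ _ _ _ _ 𝔣 _).2 ⟨fun δ x => by simp only [conjFun₂_apply, hL δ x],
    fun kk hkk x => by simp only [conjFun₂_apply, hKc kk hkk x],
    ⟨K.1.1, K.1.2.1, fun kk hkk x => by simp only [conjFun₂_apply, hK kk hkk x]⟩, fun x => ?_⟩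
  obtain ⟨q, δ, k, hk, hx⟩ := hcov (finPart (↥(maximalRealSubfield L)) L (IsCMField.complexConj L) 2 Jstar x)
  set Mx : Matrix (Fin 2) (Fin 2) ℂ := ((ratToGLℂ L Jstar τ δ⁻¹ : GL (Fin 2) ℂ) : Matrix (Fin 2) (Fin 2) ℂ) *
    (((archAt (↥(maximalRealSubfield L)) L (IsCMField.complexConj L) 2 Jstar (cmPlace L τ)
        (complexConj_smul_infinitePlace L _) (IsCMField.complexConj_ne_one L)
        (archPart (↥(maximalRealSubfield L)) L (IsCMField.complexConj L) 2 Jstar x) : archLocal L 2 Jstar (cmPlace L τ)) :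
        GL (Fin 2) ℂ) : Matrix (Fin 2) (Fin 2) ℂ).map (embTwist L τ) with hMx
  have hMxneg : ∀ w ∈ negCone (Jstar.map τ), Mx *ᵥ w ∈ negCone (Jstar.map τ) := fun w hw => by
    rw [hMx, ← Matrix.mulVec_mulVec]
    exact ratToGLℂ_mulVec_mem_negCone' (τ := τ) δ⁻¹ (map_embTwist_mulVec_mem_negCone (τ := τ) _ hw)
  let R : Matrix (Fin 2) (Fin 2) ℂ → ℂ := fun m => (α q) ((⇑(A q).isAnalytification.homeomorph.symm ∘ (B q).unif) (m *ᵥ v₀))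
    (fun _ ↦ mfderiv 𝓘(ℝ, Fin 2 → ℂ) 𝓘(ℝ, (A q).model) (⇑(A q).isAnalytification.homeomorph.symm ∘ (B q).unif) (m *ᵥ v₀) (m *ᵥ t₀))
  have hR : ∀ m, R m = (α q) ((⇑(A q).isAnalytification.homeomorph.symm ∘ (B q).unif) (m *ᵥ v₀))
    (fun _ ↦ mfderiv 𝓘(ℝ, Fin 2 → ℂ) 𝓘(ℝ, (A q).model) (⇑(A q).isAnalytification.homeomorph.symm ∘ (B q).unif) (m *ᵥ v₀) (m *ᵥ t₀)) :=
    fun m => rfl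
  -- conjugated negativity of `(of g) 𝔣.v₀`: `(ḡ) v₀ ∈ negCone J⋆^τ`
  have hneg_conj : ∀ g : Matrix (Fin 2) (Fin 2) ℂ, g *ᵥ 𝔣.v₀ ∈ negCone (Jstar.map (cmPlace L τ).1.embedding) →
      (Mx * g.map (starRingEnd ℂ)) *ᵥ v₀ ∈ (B q).cone := fun g hg => by
    change _ ∈ negCone (B q).Hℂ
    rw [hH q, ← Matrix.mulVec_mulVec]
    refine hMxneg _ ?_
    rw [conj_vec, ← hv']
    exact neg_of _ hg
  refine ⟨fun m => conj (R (Mx * m.map (starRingEnd ℂ))), ⟨?_, ?_⟩, fun u => ?_⟩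
  · -- (i) holomorphy: the symmetry principle
    intro g hg
    exact (differentiableAt_conj_coneRead_const_mul_conj (B q) (A q) (hα q) Mx v₀ t₀ (hneg_conj _ hg.2)).differentiableWithinAt
  · -- (ii) the cotangent law, conjugated
    intro g b a kk d _ hgneg hkk hb hbt
    have hb' : b.map (starRingEnd ℂ) *ᵥ v₀ = conj kk • v₀ := by
      rw [conj_vec, ← hv', hb, hv']
      funext i
      simp only [Pi.smul_apply, smul_eq_mul, map_mul, Complex.conj_conj]
    have hbt' : b.map (starRingEnd ℂ) *ᵥ t₀ = conj a • t₀ + conj d • v₀ := by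
      rw [conj_vec, ← ht', hbt, hv', ht']
      funext i
      simp only [Pi.smul_apply, Pi.add_apply, smul_eq_mul, map_mul, map_add, Complex.conj_conj]
    have hkk' : conj kk ≠ 0 := (map_ne_zero _).2 hkk
    have key := coneRead_const_mul_mul_of_mulVec_eq_smul (B q) (A q) ((hα q).isOfType.isComplexLinearForm) Mx v₀ t₀
      (hneg_conj _ hgneg) hkk' hb' hbt'
    show conj (R (Mx * (g * b).map (starRingEnd ℂ))) = (a * kk⁻¹) * conj (R (Mx * g.map (starRingEnd ℂ)))
    rw [Matrix.map_mul, hR, key, map_mul, map_mul, map_inv₀, Complex.conj_conj, Complex.conj_conj]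
  · -- the slice of `conj ∘ Φ` through `x`
    show conj (R (Mx * (((u : GL (Fin 2) ℂ) : Matrix (Fin 2) (Fin 2) ℂ).map (starRingEnd ℂ)))) = star (Φ _)
    rw [lift_apply_mul_adelicSingle A α v₀ t₀ hL hKc hK hΦ hk hx u, Complex.star_def]
    exact congrArg (fun z => conj z) (congrArg R (by rw [hMx, Matrix.mul_assoc, hmap ((u : GL (Fin 2) ℂ) : Matrix (Fin 2) (Fin 2) ℂ)]))

/-- **THE VALUE CLAUSE: any lift of the cone-read family lies in the `(1,0) ⊕ (0,1)` cotangent automorphic forms `cohForms₂ 𝔣`**, whichever of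
`τ`, `τ̄` Mathlib's embedding of the place is (`holCotForms₂ ≤ cohForms₂`, resp. `Φ = conj (conj Φ)` with `conj Φ ∈ holCotForms₂`,
★ `conjFun₂_mem_cohForms₂`). [cite: BorelWallach2000, VII 2.10 and 3.6] [cite: Borel1997, §5.13–§5.14] -/
theorem lift_mem_cohForms₂ (𝔣 : ConeFrame L Jstar (cmPlace L τ)) {v₀ t₀ : Fin 2 → ℂ}
    (hv : 𝔣.v₀ = fun i => embTwist L τ (v₀ i)) (ht : 𝔣.t₀ = fun i => embTwist L τ (t₀ i))
    (hH : ∀ q, (B q).Hℂ = Jstar.map τ) (A : ∀ q, HodgeModel 1 (X q))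
    (α : ∀ q, MForm 𝓘(ℝ, (A q).model) (A q).carrier ℂ 1) (hα : ∀ q, IsHolomorphicInCharts (α q))
    (hcov : ∀ y : ↥(finAdelic (↥(maximalRealSubfield L)) L (IsCMField.complexConj L) 2 Jstar),
      ∃ (q : Q) (δ : ↥(rational (↥(maximalRealSubfield L)) L (IsCMField.complexConj L) 2 Jstar))
        (k : ↥(finAdelic (↥(maximalRealSubfield L)) L (IsCMField.complexConj L) 2 Jstar)),
        k ∈ K.1.1 ∧ y = rationalToFinAdelic (↥(maximalRealSubfield L)) L (IsCMField.complexConj L) 2 Jstar δ * gq q * k)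
    {Φ : (adelicGroupData (↥(maximalRealSubfield L)) L (IsCMField.complexConj L) 2 Jstar).Adelic → ℂ}
    (hL : ∀ (δ : ↥(rational (↥(maximalRealSubfield L)) L (IsCMField.complexConj L) 2 Jstar))
        (x : (adelicGroupData (↥(maximalRealSubfield L)) L (IsCMField.complexConj L) 2 Jstar).Adelic),
      Φ ((adelicGroupData (↥(maximalRealSubfield L)) L (IsCMField.complexConj L) 2 Jstar).toAdelic δ * x) = Φ x)
    (hKc : ∀ k ∈ ((archAt (↥(maximalRealSubfield L)) L (IsCMField.complexConj L) 2 Jstar (cmPlace L τ)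
          (complexConj_smul_infinitePlace L _) (IsCMField.complexConj_ne_one L)).ker).map
        (archToAdelic (↥(maximalRealSubfield L)) L (IsCMField.complexConj L) 2 Jstar),
      ∀ x : (adelicGroupData (↥(maximalRealSubfield L)) L (IsCMField.complexConj L) 2 Jstar).Adelic, Φ (x * k) = Φ x)
    (hK : ∀ k ∈ K.1.1, ∀ x : (adelicGroupData (↥(maximalRealSubfield L)) L (IsCMField.complexConj L) 2 Jstar).Adelic,
      Φ (x * finAdelicToAdelic (↥(maximalRealSubfield L)) L (IsCMField.complexConj L) 2 Jstar k) = Φ x)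
    (hΦ : ∀ (q : Q) (u : archLocal L 2 Jstar (cmPlace L τ)),
        Φ (adelicSingle (↥(maximalRealSubfield L)) L (IsCMField.complexConj L) 2 Jstar (IsCMField.complexConj_ne_one L)
            (complexConj_smul_infinitePlace L) (cmPlace L τ) u *
          finAdelicToAdelic (↥(maximalRealSubfield L)) L (IsCMField.complexConj L) 2 Jstar (gq q)) =
        (α q) ((⇑(A q).isAnalytification.homeomorph.symm ∘ (B q).unif) ((((u : GL (Fin 2) ℂ) : Matrix (Fin 2) (Fin 2) ℂ).map (embTwist L τ)) *ᵥ v₀))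
          (fun _ ↦ mfderiv 𝓘(ℝ, Fin 2 → ℂ) 𝓘(ℝ, (A q).model) (⇑(A q).isAnalytification.homeomorph.symm ∘ (B q).unif)
            ((((u : GL (Fin 2) ℂ) : Matrix (Fin 2) (Fin 2) ℂ).map (embTwist L τ)) *ᵥ v₀)
            ((((u : GL (Fin 2) ℂ) : Matrix (Fin 2) (Fin 2) ℂ).map (embTwist L τ)) *ᵥ t₀))) :
    Φ ∈ cohForms₂ (↥(maximalRealSubfield L)) L (IsCMField.complexConj L) Jstar (IsCMField.complexConj_ne_one L)
      (complexConj_smul_infinitePlace L) (cmPlace L τ) 𝔣 := by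
  by_cases hemb : (InfinitePlace.mk τ).embedding = τ
  · exact holCotForms₂_le_cohForms₂ _ _ _ _ _ _ _ 𝔣
      (lift_mem_holCotForms₂_of_embedding_eq hemb 𝔣 hv ht hH A α hα hcov hL hKc hK hΦ)
  · have h := conjFun₂_mem_cohForms₂ (↥(maximalRealSubfield L)) L (IsCMField.complexConj L) Jstar (IsCMField.complexConj_ne_one L)
      (complexConj_smul_infinitePlace L) (cmPlace L τ) 𝔣
      (conjFun₂_lift_mem_holCotForms₂_of_embedding_ne hemb 𝔣 hv ht hH A α hα hcov hL hKc hK hΦ)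
    have hid : conjFun₂ (↥(maximalRealSubfield L)) L (IsCMField.complexConj L) Jstar
        (conjFun₂ (↥(maximalRealSubfield L)) L (IsCMField.complexConj L) Jstar Φ) = Φ := by
      funext x
      simp only [conjFun₂_apply, Complex.star_def, Complex.conj_conj]
    rwa [hid] at h

end Literature.AlgebraicGeometry.ShimuraVarieties.UnitaryCanonicalModel

end
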